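import Summits.BirchSwinnertonDyer.BirchSwinnertonDyer.Theorems.Rank1ResidualX9Defs
import Summits.BirchSwinnertonDyer.Rank1Residual.Supersingular.TwistStability
import Summits.BirchSwinnertonDyer.Rank1Residual.Additive.QuadraticTwistSurj
import Summits.BirchSwinnertonDyer.Rank1Residual.AdditivePotMult.Twist
import Literature.NumberTheory.EllipticCurves.QuadraticTwistKroneckerLFunctionProofs
import HarnessLib

/-!
# Class X9 is closed under quadratic twists unramified at `p`, and leaves by the ramified ones
# (cell `b2b-bsdres`, X9 prover, unit `b2b-bsdres-x9` gen 46; CLASS-CLOSURE E3 "transport" for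
# §a.2 X9, and crux K2 (class-membership half) of the K6-bis card
# `Ideas/schneider-free-x9-twin-imc-bstw1111.md`)

HONEST FRAMING (run/shared/lean/b2b/bsd-rank1-residual/, verbatim in every file): the goal of the
cell is to DELETE the COMBINATION-SHAPED residual classes of the Birch–Swinnerton-Dyer formula for
ALL analytic-rank `≤ 1` elliptic curves over `ℚ` — "full BSD formula for every rank `≤ 1` curve in
class `C`" assembled STRICTLY from published theorems — so that the rank-`≤ 1` remainder becomes
exactly the CONSTRUCTION-SHAPED classes, which are TYPED (missing-input `Prop`s), NOT attempted.
This is not "finishing BSD". Class X9 (`p ≥ 5` good ordinary, `E[p]` irreducible, `ρ̄_{E,p}` NOT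
surjective, `E` without CM) is and stays TYPED at class level (residue
`IntegralMainConjectureOnClassX9` / `BSDpOnClassX9` of `Theorems/Rank1ResidualX9Defs.lean`).
THEOREMS ONLY (no definition, no named fact, nothing about any particular curve asserted); no
label of the cell moves; nothing is booked.

## What this file proves, and why

The class predicate here is the K6 route's
`Summit.BirchSwinnertonDyer.BirchSwinnertonDyer.Rank1Residual.ClassX9 W p`
(`¬ CM ∧ 5 ≤ p ∧ good(p) ∧ p ∤ a_p ∧ irr(p) ∧ ¬ surj(p)`, the hypothesis of the K6 cruxes
`MuTransferX9` / `AnalyticMuZeroX9` and of `BSDpOnClassX9`). For globally minimal `W, W'` over `ℚ`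
with `C • W' = W^{(d)}` (`W'` a minimal model of the quadratic twist by a square-free integer `d`):

* `classX9_of_smul_eq_quadraticTwist`, **`classX9_iff_of_smul_eq_quadraticTwist`** — for
  `p ∤ d`, `W' ∈ X9 ↔ W ∈ X9`: good reduction and `p ∤ a_p` pass to the twist at `p ∤ 2d`
  (Silverman *AEC* VII.5.1(a), Knapp Prop. 12.10 `a_p(W') = (d/p) a_p(W)`; the cell's
  `Supersingular.hasGoodReductionAtPrime_of_smul_eq_quadraticTwist` /
  `dvd_frobeniusTrace_iff_of_smul_eq_quadraticTwist`), the `j`-invariant and hence `HasCM` are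
  unchanged (*AEC* X.5.4), and `E^{(d)}[p] ≅ E[p] ⊗ χ_d` carries irreducibility and
  (non-)surjectivity of `ρ̄` in both directions (the cell's `AdditivePotMult.irr_iff_of_model_twist`,
  `Additive.surj_iff_of_model_twist`; Serre 1972 §2: a scalar twist does not change the
  projective image). `ClassX9.exists_twist`: such a minimal model `W' ∈ X9` exists for every
  square-free `d` with `p ∤ d` (*AEC* VIII.8.3).
* **`not_classX9_of_smul_eq_quadraticTwist_of_dvd`**, `classX4_and_not_surj_of_…_of_dvd` — for
  `p ∣ d` the twist is RAMIFIED at the good prime `p`, so `W'` has ADDITIVE reduction at `p`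
  (*AEC* VII.5.1(c); tree `hasAdditiveReductionAt_quadraticTwist_of_dvd`) and is NOT in X9: it is
  a pair of the census class X4 with `ρ̄` irreducible and not surjective (the "O8" strand of
  `Additive/X4NonSurjectiveImageStrand.lean`). Together: **`classX9_iff_not_dvd_of_smul_eq_quadraticTwist`**
  — for `W ∈ X9` and square-free `d`, `W' ∈ X9 ↔ p ∤ d`.
* `ClassX9.padicValNat_torsionOrder` — `p ∤ #E(ℚ)_tors` on X9 (irreducible `E[p]`), the torsion
  clause asked with the twist by the card's K2.
* `classX9Census_of_smul_eq_quadraticTwist` — the census-exact predicate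
  `Literature.….Rank1Residual.ClassX9` (which adds the rank-one clause `r = 1 → ¬ semistable`,
  NOT a twist invariant) passes to the twist as soon as that clause is supplied for `W'`
  (vacuous when `r_an(W') = 0`).

READING (E3 for X9; K2 of the card): X9 is closed under every quadratic twist unramified at `p`;
the only twist exits are ramified at `p` and land in X4 (additive, potentially good — themselves
open). What this file does NOT give and the card's K2 still needs: the analytic-rank / non-vanishing
clause for the twist (`r_an(E^{(d_K)}) = 0` from the choice of `K`) and the unit-coefficient
hypothesis of `AnalyticMuZeroX9` for `f ⊗ χ_d`, which is NOT implied by the one for `f`.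

References: [SilvermanAEC2009] VII.1 Rem. 1.1, VII.5 Prop. 5.1, VIII.8 Cor. 8.3, X.5 Cor. 5.4;
[Knapp1993] Prop. 12.10; [Serre1972] §2. Design: theorems only; default heartbeats; axioms standard.
-/

set_option autoImplicit false

noncomputable section

open scoped Classical NumberField

open WeierstrassCurve IsDedekindDomain NumberField Rat.HeightOneSpectrum
  Literature.NumberTheory.EllipticCurves

open Literature.NumberTheory.EllipticCurves.Rank1Residual hiding ClassX9
open Summit.BirchSwinnertonDyer.BirchSwinnertonDyer.Rank1Residual (ClassX9)

namespace Summit.BirchSwinnertonDyer.Rank1Residual.X9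

/-! ### The model-free clauses: `j`, CM, irreducibility, surjectivity (any `d ≠ 0`) -/

section ModelFree

variable (W W' : WeierstrassCurve ℚ) [W.IsElliptic] [W'.IsElliptic] (p : ℕ) [hp : Fact p.Prime]

omit hp in
/-- A `ℚ`-model `W'` of the twist `W^{(d)}` (`C • W' = W^{(d)}`, `d ≠ 0`) has the `j`-invariant of
`W` (`j` is a `ℚ`-isomorphism invariant and `j(W^{(d)}) = j(W)`). [cite: SilvermanAEC2009, X.5 Cor. 5.4 and III.1 Prop. 1.4(b)] -/
theorem j_eq_of_smul_eq_quadraticTwist {d : ℚ} (hd : d ≠ 0) {C : VariableChange ℚ}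
    (hC : C • W' = W.quadraticTwist d) : W'.j = W.j := by
  haveI := W.isElliptic_quadraticTwist hd
  have hW' : W' = C⁻¹ • W.quadraticTwist d := by rw [← hC, inv_smul_smul]
  subst hW'
  rw [variableChange_j, W.j_quadraticTwist hd]

omit hp in
/-- **CM is a twist invariant**: for a `ℚ`-model `W'` of `W^{(d)}`, `W'` has CM iff `W` has
(same `j`; `hasCM_iff_of_j_eq`). [cite: SilvermanAEC2009, X.5 Cor. 5.4] -/
theorem hasCM_iff_of_smul_eq_quadraticTwist {d : ℚ} (hd : d ≠ 0) {C : VariableChange ℚ}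
    (hC : C • W' = W.quadraticTwist d) : W'.HasCM ↔ W.HasCM :=
  hasCM_iff_of_j_eq (j_eq_of_smul_eq_quadraticTwist W W' hd hC)

/-- **`E^{(d)}[p]` irreducible ↔ `E[p]` irreducible** on any `ℚ`-model `W'` of the twist (the
twisting isomorphism is `Γ_ℚ`-equivariant up to the sign `χ_d`, so Galois-stable lines correspond;
the cell's `AdditivePotMult.irr_iff_of_model_twist`). [cite: SilvermanAEC2009, X.5 Cor. 5.4] -/
theorem irr_iff_of_smul_eq_quadraticTwist {d : ℚ} (hd : d ≠ 0) {C : VariableChange ℚ}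
    (hC : C • W' = W.quadraticTwist d) : Irr W' p ↔ Irr W p :=
  AdditivePotMult.irr_iff_of_model_twist (W := W) (p := p) hd ⟨C⁻¹, by rw [← hC, inv_smul_smul]⟩

omit [W'.IsElliptic] in
/-- **`ρ̄_{E^{(d)},p}` surjective ↔ `ρ̄_{E,p}` surjective** on any `ℚ`-model `W'` of the twist
(`E^{(d)}[p] ≅ E[p] ⊗ χ_d`: the images agree up to the central sign, and `−1` is a square in the
image; the cell's `Additive.surj_iff_of_model_twist`). Group-theoretic reading (Serre): a scalar
twist does not change the projective image, and a subgroup of `GL₂(𝔽_p)` with full determinant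
maps onto `PGL₂(𝔽_p)` iff it is all of `GL₂(𝔽_p)`. [cite: SilvermanAEC2009, X.5 Cor. 5.4]
[cite: Serre1972, §2.4–§2.6] -/
theorem surj_iff_of_smul_eq_quadraticTwist {d : ℚ} (hd : d ≠ 0) {C : VariableChange ℚ}
    (hC : C • W' = W.quadraticTwist d) : Surj W' p ↔ Surj W p :=
  Additive.surj_iff_of_model_twist W p hd ⟨C⁻¹, by rw [← hC, inv_smul_smul]⟩

end ModelFree

/-! ### Twists unramified at `p`: X9 is closed -/

section Unramified

variable (W W' : WeierstrassCurve ℚ) [W.IsElliptic] [W.IsGloballyMinimal] [W'.IsElliptic]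
  [W'.IsGloballyMinimal] (p : ℕ) [hp : Fact p.Prime]

omit W W' in
/-- For a prime `p ≥ 5` (indeed `p ≠ 2`) and `p ∤ d`: `p ∤ 2d`. [folklore] -/
theorem not_dvd_two_mul_of_five_le (h5 : 5 ≤ p) {d : ℤ} (hpd : ¬ (p : ℤ) ∣ d) :
    ¬ (p : ℤ) ∣ 2 * d := by
  intro h
  have hpZ : Prime (p : ℤ) := Nat.prime_iff_prime_int.mp hp.out
  rcases hpZ.dvd_or_dvd h with h2 | hd
  · have h2' : p ∣ 2 := by exact_mod_cast h2
    have := Nat.le_of_dvd two_pos h2'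
    omega
  · exact hpd hd

/-- **Class X9 passes to every quadratic twist unramified at `p`**: `W ∈ X9` at `p`,
`C • W' = W^{(d)}` with `d` square-free, `p ∤ d`, `W'` globally minimal ⟹ `W' ∈ X9` at `p`
(good reduction and `p ∤ a_p` are kept at `p ∤ 2d`, `a_p(W') = (d/p)·a_p(W)`; CM, irreducibility
and non-surjectivity are twist invariants). [cite: SilvermanAEC2009, VII.5 Prop. 5.1(a) and X.5 Cor. 5.4]
[cite: Knapp1993, Prop. 12.10] -/
theorem classX9_of_smul_eq_quadraticTwist (hX : ClassX9 W p) {d : ℤ} (hd : Squarefree d)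
    {C : VariableChange ℚ} (hC : C • W' = W.quadraticTwist (d : ℚ)) (hpd : ¬ (p : ℤ) ∣ d) :
    ClassX9 W' p := by
  obtain ⟨hcm, h5, hgood, hord, hirr, hns⟩ := hX
  have hd0 : ((d : ℤ) : ℚ) ≠ 0 := by exact_mod_cast hd.ne_zero
  have hp2d : ¬ (p : ℤ) ∣ 2 * d := not_dvd_two_mul_of_five_le p h5 hpd
  refine ⟨fun h ↦ hcm ((hasCM_iff_of_smul_eq_quadraticTwist W W' hd0 hC).mp h), h5,
    Supersingular.hasGoodReductionAtPrime_of_smul_eq_quadraticTwist W W' p hC hp2d hgood,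
    fun h ↦ hord
      ((Supersingular.dvd_frobeniusTrace_iff_of_smul_eq_quadraticTwist W W' p hd hC hp2d hgood).mp h),
    (irr_iff_of_smul_eq_quadraticTwist W W' p hd0 hC).mpr hirr,
    fun h ↦ hns ((surj_iff_of_smul_eq_quadraticTwist W W' p hd0 hC).mp h)⟩

/-- **`W' ∈ X9 ↔ W ∈ X9`** for globally minimal `W, W'` with `C • W' = W^{(d)}`, `d` square-free,
`p ∤ d`: class X9 is CLOSED under quadratic twists unramified at `p` (the twist relation is
symmetric up to `ℚ`-isomorphism, `Supersingular.exists_smul_eq_quadraticTwist_symm`).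
[cite: SilvermanAEC2009, VII.5 Prop. 5.1(a) and X.5 Cor. 5.4] [cite: Knapp1993, Prop. 12.10] -/
theorem classX9_iff_of_smul_eq_quadraticTwist {d : ℤ} (hd : Squarefree d)
    {C : VariableChange ℚ} (hC : C • W' = W.quadraticTwist (d : ℚ)) (hpd : ¬ (p : ℤ) ∣ d) :
    ClassX9 W' p ↔ ClassX9 W p := by
  have hd0 : ((d : ℤ) : ℚ) ≠ 0 := by exact_mod_cast hd.ne_zero
  obtain ⟨C', hC'⟩ := Supersingular.exists_smul_eq_quadraticTwist_symm W W' hd0 hC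
  exact ⟨fun h ↦ classX9_of_smul_eq_quadraticTwist W' W p h hd hC' hpd,
    fun h ↦ classX9_of_smul_eq_quadraticTwist W W' p h hd hC hpd⟩

/-- **Every X9 pair has X9 twists by every square-free `d` with `p ∤ d`**: a globally minimal
model `W'` of `W^{(d)}` exists (*AEC* VIII.8.3, tree `hasGlobalMinimalModel_rat_holds`) and lies
in X9 at `p`. [cite: SilvermanAEC2009, VIII.8 Cor. 8.3 and X.5 Cor. 5.4] [cite: Knapp1993, Prop. 12.10] -/
theorem ClassX9.exists_twist (hX : ClassX9 W p) {d : ℤ} (hd : Squarefree d)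
    (hpd : ¬ (p : ℤ) ∣ d) :
    ∃ (W' : WeierstrassCurve ℚ) (_ : W'.IsElliptic) (_ : W'.IsGloballyMinimal)
      (C : VariableChange ℚ), C • W' = W.quadraticTwist (d : ℚ) ∧ ClassX9 W' p := by
  have hd0 : ((d : ℤ) : ℚ) ≠ 0 := by exact_mod_cast hd.ne_zero
  haveI := W.isElliptic_quadraticTwist hd0
  obtain ⟨C, hC⟩ := hasGlobalMinimalModel_rat_holds (W.quadraticTwist (d : ℚ))
  refine ⟨C • W.quadraticTwist (d : ℚ), inferInstance, hC, C⁻¹, inv_smul_smul C _, ?_⟩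
  haveI : (C • W.quadraticTwist (d : ℚ)).IsGloballyMinimal := hC
  exact classX9_of_smul_eq_quadraticTwist W (C • W.quadraticTwist (d : ℚ)) p hX hd
    (inv_smul_smul C _) hpd

omit W' [W.IsGloballyMinimal] in
/-- **`p ∤ #E(ℚ)_tors` on class X9** (`E[p]` irreducible: a rational point of order `p` would span
a Galois-stable line; tree `padicValNat_torsionOrder_eq_zero_of_irreducible`) — the torsion clause
that travels with the twist in the card's K2, since the twist is again in X9.
[cite: SilvermanAEC2009, III.7 and X.4 Thm. 4.2(a)] -/
theorem ClassX9.padicValNat_torsionOrder [W.IsGloballyMinimal] (hX : ClassX9 W p) :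
    padicValNat p W.torsionOrder = 0 :=
  padicValNat_torsionOrder_eq_zero_of_irreducible W p hX.2.2.2.2.1

end Unramified

/-! ### Twists ramified at `p`: X9 is left, towards X4 -/

section Ramified

variable (W W' : WeierstrassCurve ℚ) [W.IsElliptic] [W.IsGloballyMinimal] [W'.IsElliptic]
  [W'.IsGloballyMinimal] (p : ℕ) [hp : Fact p.Prime]

omit [W'.IsGloballyMinimal] in
/-- **A twist ramified at a good odd prime is additive there**: `W` globally minimal with good
reduction at `p ≠ 2`, `d` square-free with `p ∣ d` (so `p ∥ d`), `C • W' = W^{(d)}` ⟹ `W'` has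
neither good nor multiplicative reduction at `p` (`Addv W' p`). The twisted equation is minimal
at `p` with `ord_p Δ = 6`, `ord_p c₄ ≥ 2` (tree `hasAdditiveReductionAt_quadraticTwist_of_dvd`);
the reduction type is a `ℚ`-isomorphism invariant. [cite: SilvermanAEC2009, VII.1 Remark 1.1 and VII.5 Prop. 5.1(c)] -/
theorem addv_of_smul_eq_quadraticTwist_of_dvd (hgood : W.HasGoodReductionAtPrime p) (hp2 : p ≠ 2)
    {d : ℤ} (hd : Squarefree d) {C : VariableChange ℚ} (hC : C • W' = W.quadraticTwist (d : ℚ))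
    (hpd : (p : ℤ) ∣ d) : Addv W' p := by
  have hpP : p.Prime := hp.out
  obtain ⟨v, rfl⟩ : ∃ v : HeightOneSpectrum (𝓞 ℚ), (primesEquiv v : ℕ) = p :=
    ⟨primesEquiv.symm ⟨p, hpP⟩, by rw [Equiv.apply_symm_apply]⟩
  have hd0 : d ≠ 0 := hd.ne_zero
  have hd0q : ((d : ℤ) : ℚ) ≠ 0 := by exact_mod_cast hd0
  haveI := W.isElliptic_quadraticTwist hd0q
  -- `p² ∤ d` since `d` is square-free and `p` is not a unit
  have hp2d : ¬ ((primesEquiv v : ℕ) : ℤ) ^ 2 ∣ d := by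
    intro h
    rw [sq] at h
    have hu := hd _ h
    rw [Int.isUnit_iff_natAbs_eq, Int.natAbs_natCast] at hu
    exact hpP.one_lt.ne' hu
  have hgoodv : W.HasGoodReductionAt v :=
    (hasGoodReductionAtPrime_iff_hasGoodReductionAt_ringOfIntegers v W).mp hgood
  have hadd : (W.quadraticTwist (d : ℚ)).HasAdditiveReductionAt v :=
    hasAdditiveReductionAt_quadraticTwist_of_dvd W v hp2 hd0 hpd hp2d hgoodv
  -- transport `¬ good`, `¬ mult` from `W^{(d)} = C • W'` to `W'`
  have hng : ¬ W'.HasGoodReductionAt v := by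
    rw [← hasGoodReductionAt_smul_iff_holds v W' C, hC]
    exact hadd.not_hasGoodReductionAt
  have hnm : ¬ W'.HasMultiplicativeReductionAt v := by
    rw [← hasMultiplicativeReductionAt_smul_iff_holds v W' C, hC]
    exact hadd.not_hasMultiplicativeReductionAt
  refine ⟨fun h ↦ hng ((hasGoodReductionAtPrime_iff_hasGoodReductionAt_ringOfIntegers v W').mp h),
    fun h ↦ hnm ?_⟩
  exact (hasMultiplicativeReductionAtPrime_iff_hasMultiplicativeReductionAt_ringOfIntegers W' v).mp h

omit [W'.IsGloballyMinimal] in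
/-- **A twist of an X9 pair ramified at `p` is an X4 pair with `ρ̄` irreducible and not
surjective** (census class X4 = `p ≠ 2 ∧ Addv ∧ Irr`; the "O8" strand of
`Additive/X4NonSurjectiveImageStrand.lean`): for `W ∈ X9` at `p`, `d` square-free with `p ∣ d`
and `C • W' = W^{(d)}`. [cite: SilvermanAEC2009, VII.5 Prop. 5.1(c) and X.5 Cor. 5.4] -/
theorem classX4_and_not_surj_of_smul_eq_quadraticTwist_of_dvd (hX : ClassX9 W p) {d : ℤ}
    (hd : Squarefree d) {C : VariableChange ℚ} (hC : C • W' = W.quadraticTwist (d : ℚ))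
    (hpd : (p : ℤ) ∣ d) : ClassX4 W' p ∧ ¬ Surj W' p := by
  obtain ⟨-, h5, hgood, -, hirr, hns⟩ := hX
  have hd0 : ((d : ℤ) : ℚ) ≠ 0 := by exact_mod_cast hd.ne_zero
  have hp2 : p ≠ 2 := by omega
  exact ⟨⟨hp2, addv_of_smul_eq_quadraticTwist_of_dvd W W' p hgood hp2 hd hC hpd,
    (irr_iff_of_smul_eq_quadraticTwist W W' p hd0 hC).mpr hirr⟩,
    fun h ↦ hns ((surj_iff_of_smul_eq_quadraticTwist W W' p hd0 hC).mp h)⟩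

/-- **A twist of an X9 pair ramified at `p` is NOT in X9** (it has additive reduction at `p`).
[cite: SilvermanAEC2009, VII.5 Prop. 5.1(c)] -/
theorem not_classX9_of_smul_eq_quadraticTwist_of_dvd (hX : ClassX9 W p) {d : ℤ}
    (hd : Squarefree d) {C : VariableChange ℚ} (hC : C • W' = W.quadraticTwist (d : ℚ))
    (hpd : (p : ℤ) ∣ d) : ¬ ClassX9 W' p := fun h ↦
  (classX4_and_not_surj_of_smul_eq_quadraticTwist_of_dvd W W' p hX hd hC hpd).1.2.1.1 h.2.2.1

/-- **The twist dichotomy on X9**: for `W ∈ X9` at `p`, `d` square-free and a globally minimal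
model `W'` of `W^{(d)}`, `W' ∈ X9 ↔ p ∤ d` — X9 is closed under the twists unramified at `p` and
is left exactly by the ramified ones (towards X4). [cite: SilvermanAEC2009, VII.5 Prop. 5.1 and X.5 Cor. 5.4]
[cite: Knapp1993, Prop. 12.10] -/
theorem classX9_iff_not_dvd_of_smul_eq_quadraticTwist (hX : ClassX9 W p) {d : ℤ}
    (hd : Squarefree d) {C : VariableChange ℚ} (hC : C • W' = W.quadraticTwist (d : ℚ)) :
    ClassX9 W' p ↔ ¬ (p : ℤ) ∣ d :=
  ⟨fun h hpd ↦ not_classX9_of_smul_eq_quadraticTwist_of_dvd W W' p hX hd hC hpd h,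
    fun hpd ↦ classX9_of_smul_eq_quadraticTwist W W' p hX hd hC hpd⟩

end Ramified

/-! ### The census-exact predicate -/

section Census

variable (W W' : WeierstrassCurve ℚ) [W.IsElliptic] [W.IsGloballyMinimal] [W'.IsElliptic]
  [W'.IsGloballyMinimal] (p : ℕ) [hp : Fact p.Prime]

/-- The census-exact X9 predicate `Literature.….Rank1Residual.ClassX9` (`¬cm ∧ GoodOrd ∧ 5 ≤ p ∧
irr ∧ ¬surj ∧ (r = 1 → ¬semistable)`) passes to a twist unramified at `p` as soon as its rank-one
clause — NOT a twist invariant (analytic rank and semistability both change under twisting) — is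
supplied for `W'`; it is vacuous when `r_an(W') ≠ 1`, e.g. for the rank-zero twist of the card's
K2. [cite: SilvermanAEC2009, VII.5 Prop. 5.1(a) and X.5 Cor. 5.4] [cite: Knapp1993, Prop. 12.10] -/
theorem classX9Census_of_smul_eq_quadraticTwist
    (hX : Literature.NumberTheory.EllipticCurves.Rank1Residual.ClassX9 W p) {d : ℤ}
    (hd : Squarefree d) {C : VariableChange ℚ} (hC : C • W' = W.quadraticTwist (d : ℚ))
    (hpd : ¬ (p : ℤ) ∣ d) (hr : W'.analyticRank = 1 → ¬ Semistable W') :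
    Literature.NumberTheory.EllipticCurves.Rank1Residual.ClassX9 W' p := by
  obtain ⟨hcm, ⟨hgood, hord⟩, h5, hirr, hns, -⟩ := hX
  obtain ⟨hcm', h5', hgood', hord', hirr', hns'⟩ :=
    classX9_of_smul_eq_quadraticTwist W W' p ⟨hcm, h5, hgood, hord, hirr, hns⟩ hd hC hpd
  exact ⟨hcm', ⟨hgood', hord'⟩, h5', hirr', hns', hr⟩

end Census

end Summit.BirchSwinnertonDyer.Rank1Residual.X9

end
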